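import Summits.AtomisticToContinuum.Crystallization.Theorems.FrustratedLawDichotomyAperiodicGapRecordJunctionStepPairKernelCut

/-!
# FrustratedLawDichotomy · crux `AperiodicFrustratedLawGap` (stmt-AtomisticToContinuum-27623) — SOURCE/TARGET-DECOUPLED SECTORING for the refitted N-cells
# (critic row 1641 (D) SECTOR-103 «hysteresis is the bookkeeping of record; fallback = target-side sectoring with union glue»): the junction with the SOURCE
# families split at `(𝓡, Dense dB)` while the dense-side table and the E-cells are stepped at INDEPENDENT target-side predicates `(𝓡′, 𝓟′)`, and the kernel-cut
# certificate glued over the TARGET classes (decomp-a2c hand 2, generation 43; structural #41; DEF-FREE)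

Why: after DOOR Tᴬ (r1641) the N-cells refit a source cell family into a target family that need not respect the source's sector (`RecutOf A`, ‖A‖ ≤ 3/160, moves strict
thresholds by a relative 3/160).  `RefineGB 𝓘_N 𝓗 … B` and `PairKernelCert 𝓣 … B` read the table `B` AT THE TARGET chart, so the step predicate of the dense table is a
TARGET-side predicate; the source split is free to differ.  This file supplies both bookkeeping devices of the ruling, most general first:

* §1 ★★ `pairKernelCert_stepPair_of_two` / `_of_three` — UNION GLUE over target classes: certificates on `famAnd 𝓣 𝓟` at `B₁` and on `famAndNot 𝓣 𝓟` at `B₂` give ONE certificate on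
  the un-sectored target `𝓣` at `stepPair 𝓟 B₁ B₂` (and the nested three-table form); `slavingEnclosureG_of_two` likewise; ★★ `refineGB_stepPair_of_kernelCut_glued` /
  `refineGB_stepPair3_of_kernelCut_glued` — the N-cell of ANY source family refitted (any `𝓑`, `(τ₁,T₁)`) into an UN-SECTORED target `𝓣` with per-target-class certificates.
* §2 ★★ `coreOff_26_5_of_fourSector_split` / `rim_26_5_of_fourSector_split` — the four-sector junction with the SOURCE N-families split at `(𝓡, Dense dB)` and the table /
  E-cells stepped at ANY `(𝓡′, 𝓟′)` (hysteresis: `𝓡′ := 𝓡⁺`; #36 §4 is the diagonal `𝓡′ = 𝓡`, `𝓟′ = Dense dB`).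
* §3 ★★★ consumers: `aperiodicFrustratedLawGap_of_homFloor_fourSector_split_A35000_T26_record` (bare floor) and `…_of_semOKF_semOKHQ_fourSector_split_kernelCutGlued_…`
  ((N∣𝔇′) and (N∣𝔅lo) by refits into un-sectored targets `𝓣_D`, `𝓣_B` with glued per-class certificates; (N∣𝔅hi) a binder).

One-line compositions of landed theorems; 0 sorry; no definitions; standard axioms.  `--supports stmt-AtomisticToContinuum-27623`.  [folklore instantiation]
-/

noncomputable section

open scoped BigOperators Classical RealInnerProductSpace
open Literature.Analysis.ValidatedNumerics.Numerics
open Summit.AtomisticToContinuum.Crystallization.Theorems.ChargedEnergyGapNegative (eStar E3)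
open Summit.AtomisticToContinuum.Crystallization.Theorems.FrustratedLawDichotomyRangeCut
open Summit.AtomisticToContinuum.Crystallization.Theorems.FrustratedLawDichotomySchurCut
open Summit.AtomisticToContinuum.Crystallization.Theorems.FrustratedLawDichotomyMotifLemmas (GoodAtScale)
open Summit.AtomisticToContinuum.Crystallization.Theorems.FrustratedLawDichotomyAveragingCut (ballAvg)
open Summit.AtomisticToContinuum.Crystallization.Theorems.FrustratedLawDichotomyExemptLocOpt (LocOptFails)
open Summit.AtomisticToContinuum.Crystallization.Theorems.FrustratedLawDichotomyExemptSplit (SchurElasticPricingX)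
open Summit.AtomisticToContinuum.Crystallization.Theorems.FrustratedLawDichotomyExemptAbsorptionRecord
open Summit.AtomisticToContinuum.Crystallization.Theorems.FrustratedLawDichotomyCollarCensus
open Summit.AtomisticToContinuum.Crystallization.Theorems.FrustratedLawDichotomyCollarCensusKappa
open Summit.AtomisticToContinuum.Crystallization.Theorems.FrustratedLawDichotomyStrainedPatchHomSplit
open Summit.AtomisticToContinuum.Crystallization.Theorems.FrustratedLawDichotomyStrainedPatchCleanCollar (CleanBall TailPenalty AnnularDefectFloor
  DefectiveCollarFloor tailOut)
open Summit.AtomisticToContinuum.Crystallization.Theorems.FrustratedLawDichotomyStrainedPatchPhaseCut (MonoPhaseBall AnnularPhaseFloor PolyTextureFloor)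
open Summit.AtomisticToContinuum.Crystallization.Theorems.FrustratedLawDichotomyStrainedPatchCoreTube (NearHomIsoAt CoreOffTubeFloor RimOffTubeFloor)
open Summit.AtomisticToContinuum.Crystallization.Theorems.FrustratedLawDichotomyStrainedPatchCoreTubeRecord (CoreCoreRelief)
open Summit.AtomisticToContinuum.Crystallization.Theorems.FrustratedLawDichotomyStrainedPatchChartFamilies (ChartBy FamilyLE familyLE_refl)
open Summit.AtomisticToContinuum.Crystallization.Theorems.FrustratedLawDichotomyStrainedPatchQuantSlaving
open Summit.AtomisticToContinuum.Crystallization.Theorems.FrustratedLawDichotomyStrainedPatchHostCells (TubeFloor)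
open Summit.AtomisticToContinuum.Crystallization.Theorems.FrustratedLawDichotomyStrainedPatchGradedTube
open Summit.AtomisticToContinuum.Crystallization.Theorems.FrustratedLawDichotomyStrainedPatchCoverBridge
open Summit.AtomisticToContinuum.Crystallization.Theorems.FrustratedLawDichotomyStrainedPatchPairTube
open Summit.AtomisticToContinuum.Crystallization.Theorems.FrustratedLawDichotomyStrainedPatchKernelCut
open Summit.AtomisticToContinuum.Crystallization.Theorems.FrustratedLawDichotomyStrainedPatchHomCertTree (CertTree treeOK)
open Summit.AtomisticToContinuum.Crystallization.Theorems.FrustratedLawDichotomyStrainedPatchHomEntryGram (rootC rootW)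
open Summit.AtomisticToContinuum.Crystallization.Theorems.FrustratedLawDichotomyStrainedPatchHomEntryLeafHT (entryLeafOK6RBKP4 semOKH semOKF)
open Summit.AtomisticToContinuum.Crystallization.Theorems.FrustratedLawDichotomyStrainedPatchHomEntrySemanticQuot (semOKHQ rootCHQ rootWHQ)
open Summit.AtomisticToContinuum.Crystallization.Theorems.FrustratedLawDichotomyAperiodicGapRecordJunctionHomFloorF6pT26
open Summit.AtomisticToContinuum.Crystallization.Theorems.FrustratedLawDichotomyAperiodicGapRecordJunctionHomFloorF6pT26Quot (homFloor_of_semOKF_semOKHQ)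
open Summit.AtomisticToContinuum.Crystallization.Theorems.FrustratedLawDichotomyAperiodicGapRecordJunctionFallbackLever (rim_of_coreOffTubeFloor)
open Summit.AtomisticToContinuum.Crystallization.Theorems.FrustratedLawDichotomyStrainedPatchConeAnatomy
open Summit.AtomisticToContinuum.Crystallization.Theorems.FrustratedLawDichotomyStrainedPatchStiffSector
open Summit.AtomisticToContinuum.Crystallization.Theorems.FrustratedLawDichotomyStrainedPatchStiffDoor
open Summit.AtomisticToContinuum.Crystallization.Theorems.FrustratedLawDichotomyStrainedPatchKernelCutSector
open Summit.AtomisticToContinuum.Crystallization.Theorems.FrustratedLawDichotomyStrainedPatchShearDoor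
open Summit.AtomisticToContinuum.Crystallization.Theorems.FrustratedLawDichotomyStrainedPatchPairTubeCollar
open Summit.AtomisticToContinuum.Crystallization.Theorems.FrustratedLawDichotomyAperiodicGapRecordJunctionFourSectorCollar
open Summit.AtomisticToContinuum.Crystallization.Theorems.FrustratedLawDichotomyAperiodicGapRecordJunctionStepPairKernelCut

namespace Summit.AtomisticToContinuum.Crystallization.Theorems.FrustratedLawDichotomyAperiodicGapRecordJunctionHysteresis

/-! ## §1. Union glue over TARGET classes for the kernel-cut certificate; the N-cell into an un-sectored target -/

section Glue

variable {𝓘_N 𝓣 𝓗 𝓡 𝓟 : ChartFam} {𝓑 : BalPred} {ρ ε η₂ τ₀ τ₁ τ κ σ : ℝ} {T₀ T₁ T : SlackTab} {H : HessTab} {F : ForceTab} {X : SlackTab}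
  {B₁ B₂ B₃ : PairTab}

/-- ★★ **UNION GLUE**: certificates on the two TARGET classes `famAnd 𝓣 𝓟` (at `B₁`) and `famAndNot 𝓣 𝓟` (at `B₂`) give one certificate on the un-sectored target `𝓣` at the stepped
table `stepPair 𝓟 B₁ B₂` (`by_cases` on the class of the target chart; `ChartByGB.mono_family` + `congr_pair`). [formal bookkeeping] -/
theorem pairKernelCert_stepPair_of_two (h₁ : PairKernelCert (famAnd 𝓣 𝓟) 𝓑 τ₁ T₁ κ σ H F X τ T B₁)
    (h₂ : PairKernelCert (famAndNot 𝓣 𝓟) 𝓑 τ₁ T₁ κ σ H F X τ T B₂) : PairKernelCert 𝓣 𝓑 τ₁ T₁ κ σ H F X τ T (stepPair 𝓟 B₁ B₂) := by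
  intro M z c M₀ z₀ c₀ e hch hb hin
  by_cases hp : 𝓟 M₀ z₀ c₀
  · exact ((h₁ M z c M₀ z₀ c₀ e ⟨⟨⟨hch.1.1, hp⟩, hch.1.2⟩, hch.2⟩ hb hin).mono_family famAnd_le).congr_pair
      fun a b => (stepPair_of_pos hp a b).symm
  · exact ((h₂ M z c M₀ z₀ c₀ e ⟨⟨⟨hch.1.1, hp⟩, hch.1.2⟩, hch.2⟩ hb hin).mono_family famAndNot_le).congr_pair
      fun a b => (stepPair_of_neg hp a b).symm

/-- ★ … nested: three target classes `famAnd 𝓣 𝓡` (at `B₁`), `famAnd (famAndNot 𝓣 𝓡) 𝓟` (at `B₂`), `famAndNot (famAndNot 𝓣 𝓡) 𝓟` (at `B₃`) ⟹ `𝓣` at `stepPair 𝓡 B₁ (stepPair 𝓟 B₂ B₃)`.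
[formal bookkeeping] -/
theorem pairKernelCert_stepPair_of_three (h₁ : PairKernelCert (famAnd 𝓣 𝓡) 𝓑 τ₁ T₁ κ σ H F X τ T B₁)
    (h₂ : PairKernelCert (famAnd (famAndNot 𝓣 𝓡) 𝓟) 𝓑 τ₁ T₁ κ σ H F X τ T B₂) (h₃ : PairKernelCert (famAndNot (famAndNot 𝓣 𝓡) 𝓟) 𝓑 τ₁ T₁ κ σ H F X τ T B₃) :
    PairKernelCert 𝓣 𝓑 τ₁ T₁ κ σ H F X τ T (stepPair 𝓡 B₁ (stepPair 𝓟 B₂ B₃)) :=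
  pairKernelCert_stepPair_of_two h₁ (pairKernelCert_stepPair_of_two h₂ h₃)

/-- ★ (E κ) on the un-sectored target from (E κ) on its two classes. [formal bookkeeping] -/
theorem slavingEnclosureG_of_two (h₁ : SlavingEnclosureG (famAnd 𝓣 𝓟) 𝓑 ρ ε η₂ τ₁ T₁ κ σ H F X)
    (h₂ : SlavingEnclosureG (famAndNot 𝓣 𝓟) 𝓑 ρ ε η₂ τ₁ T₁ κ σ H F X) : SlavingEnclosureG 𝓣 𝓑 ρ ε η₂ τ₁ T₁ κ σ H F X := by
  intro M z c M₀ z₀ c₀ e hz hcl hm hn hg hch hb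
  by_cases hp : 𝓟 M₀ z₀ c₀
  · exact h₁ M z c M₀ z₀ c₀ e hz hcl hm hn hg ⟨⟨⟨hch.1.1, hp⟩, hch.1.2⟩, hch.2⟩ hb
  · exact h₂ M z c M₀ z₀ c₀ e hz hcl hm hn hg ⟨⟨⟨hch.1.1, hp⟩, hch.1.2⟩, hch.2⟩ hb

/-- ★★ **THE N-CELL OF ANY SOURCE FAMILY REFITTED INTO AN UN-SECTORED TARGET `𝓣`** (any balance `𝓑`, refit data `(τ₁, T₁)`, hull `𝓗 ⊇ 𝓣`) with the certificate supplied PER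
TARGET CLASS: `B₁` on `famAnd 𝓣 𝓟`, `B₂` on `famAndNot 𝓣 𝓟` — the table is read at the target, so no transport of the source's sector is needed.
[folklore instantiation: `refineGB_of_kernelCut_mono` at `pairKernelCert_stepPair_of_two`] -/
theorem refineGB_stepPair_of_kernelCut_glued (h𝓗 : FamilyLE 𝓣 𝓗) (hR : BalancedRefit 𝓘_N 𝓣 𝓑 ρ ε η₂ τ₀ T₀ τ₁ T₁)
    (hE : SlavingEnclosureG 𝓣 𝓑 ρ ε η₂ τ₁ T₁ κ σ H F X) (h₁ : PairKernelCert (famAnd 𝓣 𝓟) 𝓑 τ₁ T₁ κ σ H F X τ T B₁)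
    (h₂ : PairKernelCert (famAndNot 𝓣 𝓟) 𝓑 τ₁ T₁ κ σ H F X τ T B₂) : RefineGB 𝓘_N 𝓗 ρ ε η₂ τ₀ T₀ τ T (stepPair 𝓟 B₁ B₂) :=
  refineGB_of_kernelCut_mono h𝓗 hR hE (pairKernelCert_stepPair_of_two h₁ h₂)

/-- ★★ … at the nested three-table form. [folklore instantiation] -/
theorem refineGB_stepPair3_of_kernelCut_glued (h𝓗 : FamilyLE 𝓣 𝓗) (hR : BalancedRefit 𝓘_N 𝓣 𝓑 ρ ε η₂ τ₀ T₀ τ₁ T₁)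
    (hE : SlavingEnclosureG 𝓣 𝓑 ρ ε η₂ τ₁ T₁ κ σ H F X) (h₁ : PairKernelCert (famAnd 𝓣 𝓡) 𝓑 τ₁ T₁ κ σ H F X τ T B₁)
    (h₂ : PairKernelCert (famAnd (famAndNot 𝓣 𝓡) 𝓟) 𝓑 τ₁ T₁ κ σ H F X τ T B₂) (h₃ : PairKernelCert (famAndNot (famAndNot 𝓣 𝓡) 𝓟) 𝓑 τ₁ T₁ κ σ H F X τ T B₃) :
    RefineGB 𝓘_N 𝓗 ρ ε η₂ τ₀ T₀ τ T (stepPair 𝓡 B₁ (stepPair 𝓟 B₂ B₃)) :=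
  refineGB_of_kernelCut_mono h𝓗 hR hE (pairKernelCert_stepPair_of_three h₁ h₂ h₃)

end Glue

/-! ## §2. The four-sector junction with the SOURCE split at `(𝓡, Dense dB)` and the table / E-cells stepped at independent `(𝓡′, 𝓟′)` -/

section Split

variable {𝓘₀ 𝓗 𝓘 𝓡 𝓡' 𝓟' : ChartFam} {dA dB : ℝ} {B₁ B₂ B₃ : PairTab}

/-- ★★ **[CORE-FAR] AT `26/5`, SOURCE/TARGET-DECOUPLED SECTORING**: E-cells on the target classes `𝓡′` / `¬𝓡′ ∧ 𝓟′` / `¬𝓡′ ∧ ¬𝓟′` (inside the dense sector) at `B₁/B₂/B₃`,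
N-cells for the source families split at `𝓡` / `¬𝓡 ∧ Dense dB` / `¬𝓡 ∧ ¬Dense dB`, ALL at the target-side table `stepPair 𝓡′ B₁ (stepPair 𝓟′ B₂ B₃)`, cover, hulls, cap
⟹ `CoreOffTubeFloor (63/10) (63/10) (26/5) (1/100) 0`.  [formal bookkeeping: #36 `tubeFloorGB_threeSector_stepPair` + node `tubeFloorGB_stepPair` (E), tree `refineGB_threeSector` +
`refineGB_band_of_two` (N; both table-generic), root `coreOff_of_tubeFloorGB_of_coarse_of_refineGB`] -/
theorem coreOff_26_5_of_fourSector_split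
    (hED : TubeFloorGB (famAnd (famAnd 𝓘 (Dense dA)) 𝓡') (1 / 25) (constTol (1 / 25)) B₁)
    (hEBlo : TubeFloorGB (famAnd (famAndNot (famAnd 𝓘 (Dense dA)) 𝓡') 𝓟') (1 / 25) (constTol (1 / 25)) B₂)
    (hEBhi : TubeFloorGB (famAndNot (famAndNot (famAnd 𝓘 (Dense dA)) 𝓡') 𝓟') (1 / 25) (constTol (1 / 25)) B₃)
    (hEA : TubeFloor (famAndNot 𝓘 (Dense dA)) (1 / 25)) (hK : FamilyCoverGRecAt 𝓘₀ (26 / 5) (1 / 100))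
    (hND : RefineGB (famAnd (famAnd 𝓘₀ (Dense dA)) 𝓡) 𝓗 (26 / 5) (1 / 100) (1 / 8) (1 / 25) (constTol (1 / 25)) (1 / 25) (constTol (1 / 25))
      (stepPair 𝓡' B₁ (stepPair 𝓟' B₂ B₃)))
    (hNBlo : RefineGB (famAnd (famAndNot (famAnd 𝓘₀ (Dense dA)) 𝓡) (Dense dB)) 𝓗 (26 / 5) (1 / 100) (1 / 8) (1 / 25) (constTol (1 / 25)) (1 / 25)
      (constTol (1 / 25)) (stepPair 𝓡' B₁ (stepPair 𝓟' B₂ B₃)))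
    (hNBhi : RefineGB (famAndNot (famAndNot (famAnd 𝓘₀ (Dense dA)) 𝓡) (Dense dB)) 𝓗 (26 / 5) (1 / 100) (1 / 8) (1 / 25) (constTol (1 / 25)) (1 / 25)
      (constTol (1 / 25)) (stepPair 𝓡' B₁ (stepPair 𝓟' B₂ B₃)))
    (h𝓗 : FamilyLE (famAndNot 𝓘₀ (Dense dA)) 𝓗) (hcap : PairLE (stepPair 𝓡' B₁ (stepPair 𝓟' B₂ B₃)) (pairSum (constTol (1 / 25))))
    (h𝓘 : FamilyLE 𝓗 𝓘) : CoreOffTubeFloor (63 / 10) (63 / 10) (26 / 5) (1 / 100) 0 :=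
  coreOff_of_tubeFloorGB_of_coarse_of_refineGB (tubeFloorGB_threeSector_stepPair hED (tubeFloorGB_stepPair hEBlo hEBhi) hEA) hK
    ((refineGB_threeSector hND (refineGB_band_of_two hNBlo hNBhi) h𝓗 le_rfl (TolLE.refl _) hcap).mono h𝓘 (TolLE.refl _) (PairLE.refl _) le_rfl)

/-- ★★ **RIM `(24/5, 1/100) → (26/5, 1/100)` with source/target-decoupled sectoring.** [formal bookkeeping: `rim_of_coreOffTubeFloor`] -/
theorem rim_26_5_of_fourSector_split
    (hED : TubeFloorGB (famAnd (famAnd 𝓘 (Dense dA)) 𝓡') (1 / 25) (constTol (1 / 25)) B₁)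
    (hEBlo : TubeFloorGB (famAnd (famAndNot (famAnd 𝓘 (Dense dA)) 𝓡') 𝓟') (1 / 25) (constTol (1 / 25)) B₂)
    (hEBhi : TubeFloorGB (famAndNot (famAndNot (famAnd 𝓘 (Dense dA)) 𝓡') 𝓟') (1 / 25) (constTol (1 / 25)) B₃)
    (hEA : TubeFloor (famAndNot 𝓘 (Dense dA)) (1 / 25)) (hK : FamilyCoverGRecAt 𝓘₀ (26 / 5) (1 / 100))
    (hND : RefineGB (famAnd (famAnd 𝓘₀ (Dense dA)) 𝓡) 𝓗 (26 / 5) (1 / 100) (1 / 8) (1 / 25) (constTol (1 / 25)) (1 / 25) (constTol (1 / 25))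
      (stepPair 𝓡' B₁ (stepPair 𝓟' B₂ B₃)))
    (hNBlo : RefineGB (famAnd (famAndNot (famAnd 𝓘₀ (Dense dA)) 𝓡) (Dense dB)) 𝓗 (26 / 5) (1 / 100) (1 / 8) (1 / 25) (constTol (1 / 25)) (1 / 25)
      (constTol (1 / 25)) (stepPair 𝓡' B₁ (stepPair 𝓟' B₂ B₃)))
    (hNBhi : RefineGB (famAndNot (famAndNot (famAnd 𝓘₀ (Dense dA)) 𝓡) (Dense dB)) 𝓗 (26 / 5) (1 / 100) (1 / 8) (1 / 25) (constTol (1 / 25)) (1 / 25)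
      (constTol (1 / 25)) (stepPair 𝓡' B₁ (stepPair 𝓟' B₂ B₃)))
    (h𝓗 : FamilyLE (famAndNot 𝓘₀ (Dense dA)) 𝓗) (hcap : PairLE (stepPair 𝓡' B₁ (stepPair 𝓟' B₂ B₃)) (pairSum (constTol (1 / 25))))
    (h𝓘 : FamilyLE 𝓗 𝓘) : RimOffTubeFloor (63 / 10) (63 / 10) (24 / 5) (1 / 100) (26 / 5) (1 / 100) 0 :=
  rim_of_coreOffTubeFloor (by norm_num) (coreOff_26_5_of_fourSector_split hED hEBlo hEBhi hEA hK hND hNBlo hNBhi h𝓗 hcap h𝓘)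

/-- CONSISTENCY: #36 §4 (`coreOff_26_5_of_fourSector_stepPair`) is the diagonal `𝓡′ := 𝓡`, `𝓟′ := Dense dB`. [formal bookkeeping] -/
example
    (hED : TubeFloorGB (famAnd (famAnd 𝓘 (Dense dA)) 𝓡) (1 / 25) (constTol (1 / 25)) B₁)
    (hEBlo : TubeFloorGB (famAnd (famAndNot (famAnd 𝓘 (Dense dA)) 𝓡) (Dense dB)) (1 / 25) (constTol (1 / 25)) B₂)
    (hEBhi : TubeFloorGB (famAndNot (famAndNot (famAnd 𝓘 (Dense dA)) 𝓡) (Dense dB)) (1 / 25) (constTol (1 / 25)) B₃)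
    (hEA : TubeFloor (famAndNot 𝓘 (Dense dA)) (1 / 25)) (hK : FamilyCoverGRecAt 𝓘₀ (26 / 5) (1 / 100))
    (hND : RefineGB (famAnd (famAnd 𝓘₀ (Dense dA)) 𝓡) 𝓗 (26 / 5) (1 / 100) (1 / 8) (1 / 25) (constTol (1 / 25)) (1 / 25) (constTol (1 / 25))
      (stepPair 𝓡 B₁ (stepPair (Dense dB) B₂ B₃)))
    (hNBlo : RefineGB (famAnd (famAndNot (famAnd 𝓘₀ (Dense dA)) 𝓡) (Dense dB)) 𝓗 (26 / 5) (1 / 100) (1 / 8) (1 / 25) (constTol (1 / 25)) (1 / 25)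
      (constTol (1 / 25)) (stepPair 𝓡 B₁ (stepPair (Dense dB) B₂ B₃)))
    (hNBhi : RefineGB (famAndNot (famAndNot (famAnd 𝓘₀ (Dense dA)) 𝓡) (Dense dB)) 𝓗 (26 / 5) (1 / 100) (1 / 8) (1 / 25) (constTol (1 / 25)) (1 / 25)
      (constTol (1 / 25)) (stepPair 𝓡 B₁ (stepPair (Dense dB) B₂ B₃)))
    (h𝓗 : FamilyLE (famAndNot 𝓘₀ (Dense dA)) 𝓗) (hcap : PairLE (stepPair 𝓡 B₁ (stepPair (Dense dB) B₂ B₃)) (pairSum (constTol (1 / 25))))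
    (h𝓘 : FamilyLE 𝓗 𝓘) : CoreOffTubeFloor (63 / 10) (63 / 10) (26 / 5) (1 / 100) 0 :=
  coreOff_26_5_of_fourSector_split hED hEBlo hEBhi hEA hK hND hNBlo hNBhi h𝓗 hcap h𝓘

end Split

/-! ## §3. ★★★ The 27623 consumers with source/target-decoupled sectoring -/

section Consumers

variable {𝓘₀ 𝓗 𝓘 𝓡 𝓡' 𝓟' 𝓣D 𝓣B : ChartFam} {𝓑 𝓑' : BalPred} {dA dB τ₁ τ₁' κ κ' σ σ' : ℝ} {T₁ T₁' : SlackTab} {H H' : HessTab} {F F' : ForceTab}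
  {X X' : SlackTab} {B₁ B₂ B₃ : PairTab}

/-- ★★ **(F₆′) under (α) FROM THE BARE FLOOR WITH THE SOURCE/TARGET-DECOUPLED FOUR-SECTOR CELLS** (§2 junction + RIM). [folklore instantiation] -/
theorem aperiodicFrustratedLawGap_of_homFloor_fourSector_split_A35000_T26_record {εE CE DE DX : ℝ}
    (hε0 : 0 < εE) (hε1 : εE ≤ 1 / 10000) (hDX : 0 ≤ DX)
    (hE : SchurElasticPricingX (1 / 20) (1 / 8) w₄₅ ω₄ (3 / 400) (-(7175 / 10000)) (1 / 10000) CE DE DX (LocOptFails eStar εE (3 / 2) 1))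
    (hH : HomFloor (3 / 5000 + 13 / 50000))
    (hT : ∀ (M : ℕ) (z : Fin M → E3) (c : Fin M), Admissible M z c → CleanBall (63 / 10) z c → MonoPhaseBall (63 / 10) z c →
      NearHomIsoAt (26 / 5) (1 / 100) z c → -(13 / 50000) ≤ ballAvg (9 / 5) z (tailOut (26 / 5) M z c) c)
    (hR : CoreCoreRelief (63 / 10) (63 / 10) (26 / 5) (1 / 100) (3 / 5000))
    (hED : TubeFloorGB (famAnd (famAnd 𝓘 (Dense dA)) 𝓡') (1 / 25) (constTol (1 / 25)) B₁)
    (hEBlo : TubeFloorGB (famAnd (famAndNot (famAnd 𝓘 (Dense dA)) 𝓡') 𝓟') (1 / 25) (constTol (1 / 25)) B₂)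
    (hEBhi : TubeFloorGB (famAndNot (famAndNot (famAnd 𝓘 (Dense dA)) 𝓡') 𝓟') (1 / 25) (constTol (1 / 25)) B₃)
    (hEA : TubeFloor (famAndNot 𝓘 (Dense dA)) (1 / 25)) (hK : FamilyCoverGRecAt 𝓘₀ (26 / 5) (1 / 100))
    (hND : RefineGB (famAnd (famAnd 𝓘₀ (Dense dA)) 𝓡) 𝓗 (26 / 5) (1 / 100) (1 / 8) (1 / 25) (constTol (1 / 25)) (1 / 25) (constTol (1 / 25))
      (stepPair 𝓡' B₁ (stepPair 𝓟' B₂ B₃)))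
    (hNBlo : RefineGB (famAnd (famAndNot (famAnd 𝓘₀ (Dense dA)) 𝓡) (Dense dB)) 𝓗 (26 / 5) (1 / 100) (1 / 8) (1 / 25) (constTol (1 / 25)) (1 / 25)
      (constTol (1 / 25)) (stepPair 𝓡' B₁ (stepPair 𝓟' B₂ B₃)))
    (hNBhi : RefineGB (famAndNot (famAndNot (famAnd 𝓘₀ (Dense dA)) 𝓡) (Dense dB)) 𝓗 (26 / 5) (1 / 100) (1 / 8) (1 / 25) (constTol (1 / 25)) (1 / 25)
      (constTol (1 / 25)) (stepPair 𝓡' B₁ (stepPair 𝓟' B₂ B₃)))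
    (h𝓗 : FamilyLE (famAndNot 𝓘₀ (Dense dA)) 𝓗) (hcap : PairLE (stepPair 𝓡' B₁ (stepPair 𝓟' B₂ B₃)) (pairSum (constTol (1 / 25))))
    (h𝓘 : FamilyLE 𝓗 𝓘)
    (hF : AnnularPhaseFloor (63 / 10) (24 / 5) (63 / 10) (1 / 1000)) (hP : PolyTextureFloor (63 / 10) (24 / 5) (1 / 1000))
    (hA : AnnularDefectFloor (24 / 5) (63 / 10)) (hD : DefectiveCollarFloor (24 / 5))
    (h2 : CrowdedCoreMotifPricingCapK (1 / 1000) (9 / 5) (133 / 10) (3 / 2) (effPot w₄₅ ω₄ (3 / 400)) (-(7175 / 10000) + 3 / 400)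
      (Collar (9 / 2) fun N y j => (∃ s : ℝ, 0 ≤ s ∧ s ≤ 3 / 2 ∧ NonEquilibriumCore (-(7175 / 10000)) 0 7 s (1 / 10000) N y j) ∨
        GoodAtScale (1 / 20) (3 / 2) y j))
    (h3 : DiluteDefectMotifPricingCapK (1 / 1000) (9 / 5) (133 / 10) (3 / 2) (effPot w₄₅ ω₄ (3 / 400)) (-(7175 / 10000) + 3 / 400)
      (Collar (9 / 2) fun N y j => (∃ s : ℝ, 0 ≤ s ∧ s ≤ 3 / 2 ∧ NonEquilibriumCore (-(7175 / 10000)) 0 7 s (1 / 10000) N y j) ∨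
        GoodAtScale (1 / 20) (3 / 2) y j)) :
    Summit.AtomisticToContinuum.Crystallization.Theses.FrustratedLawDichotomy.AperiodicFrustratedLawGap :=
  aperiodicFrustratedLawGap_of_homFloor_fallbackLever_rim_A35000_T26_record hε0 hε1 hDX hE hH hT hR
    ((coreOff_26_5_of_fourSector_split hED hEBlo hEBhi hEA hK hND hNBlo hNBhi h𝓗 hcap h𝓘).of_le_core (by norm_num)) (rim_26_5_of_fourSector_split hED hEBlo hEBhi hEA hK hND hNBlo hNBhi h𝓗 hcap h𝓘) hF hP hA hD
    h2 h3

/-- ★★★ **(F₆′) under (α), QUOTIENT CURRENCY, DECOUPLED SECTORING, (N∣𝔇′) AND (N∣𝔅lo) BY REFITS INTO UN-SECTORED TARGETS `𝓣_D`, `𝓣_B` WITH GLUED PER-TARGET-CLASS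
CERTIFICATES** (any balances `𝓑`, `𝓑′` — DOOR Tᴬ: `affBal (24/5)`, target `CompFamilyW`-side — and refit data); (N∣𝔅hi) a binder. [folklore instantiation: §3 bare floor at
`homFloor_of_semOKF_semOKHQ`, §1 `refineGB_stepPair3_of_kernelCut_glued` ×2] -/
theorem aperiodicFrustratedLawGap_of_semOKF_semOKHQ_fourSector_split_kernelCutGlued_A35000_T26_record {εE CE DE DX : ℝ}
    (hε0 : 0 < εE) (hε1 : εE ≤ 1 / 10000) (hDX : 0 ≤ DX)
    (hE : SchurElasticPricingX (1 / 20) (1 / 8) w₄₅ ω₄ (3 / 400) (-(7175 / 10000)) (1 / 10000) CE DE DX (LocOptFails eStar εE (3 / 2) 1))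
    (hFcc : semOKF (-399210329969189) rootC rootW = true)
    (hHcp : semOKHQ (-399210329969189) rootCHQ rootWHQ = true)
    (hT : ∀ (M : ℕ) (z : Fin M → E3) (c : Fin M), Admissible M z c → CleanBall (63 / 10) z c → MonoPhaseBall (63 / 10) z c →
      NearHomIsoAt (26 / 5) (1 / 100) z c → -(13 / 50000) ≤ ballAvg (9 / 5) z (tailOut (26 / 5) M z c) c)
    (hR : CoreCoreRelief (63 / 10) (63 / 10) (26 / 5) (1 / 100) (3 / 5000))
    (hED : TubeFloorGB (famAnd (famAnd 𝓘 (Dense dA)) 𝓡') (1 / 25) (constTol (1 / 25)) B₁)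
    (hEBlo : TubeFloorGB (famAnd (famAndNot (famAnd 𝓘 (Dense dA)) 𝓡') 𝓟') (1 / 25) (constTol (1 / 25)) B₂)
    (hEBhi : TubeFloorGB (famAndNot (famAndNot (famAnd 𝓘 (Dense dA)) 𝓡') 𝓟') (1 / 25) (constTol (1 / 25)) B₃)
    (hEA : TubeFloor (famAndNot 𝓘 (Dense dA)) (1 / 25)) (hK : FamilyCoverGRecAt 𝓘₀ (26 / 5) (1 / 100))
    (h𝓣D : FamilyLE 𝓣D 𝓗)
    (hRD : BalancedRefit (famAnd (famAnd 𝓘₀ (Dense dA)) 𝓡) 𝓣D 𝓑 (26 / 5) (1 / 100) (1 / 8) (1 / 25) (constTol (1 / 25)) τ₁ T₁)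
    (hEncD : SlavingEnclosureG 𝓣D 𝓑 (26 / 5) (1 / 100) (1 / 8) τ₁ T₁ κ σ H F X)
    (hPD₁ : PairKernelCert (famAnd 𝓣D 𝓡') 𝓑 τ₁ T₁ κ σ H F X (1 / 25) (constTol (1 / 25)) B₁)
    (hPD₂ : PairKernelCert (famAnd (famAndNot 𝓣D 𝓡') 𝓟') 𝓑 τ₁ T₁ κ σ H F X (1 / 25) (constTol (1 / 25)) B₂)
    (hPD₃ : PairKernelCert (famAndNot (famAndNot 𝓣D 𝓡') 𝓟') 𝓑 τ₁ T₁ κ σ H F X (1 / 25) (constTol (1 / 25)) B₃)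
    (h𝓣B : FamilyLE 𝓣B 𝓗)
    (hRB : BalancedRefit (famAnd (famAndNot (famAnd 𝓘₀ (Dense dA)) 𝓡) (Dense dB)) 𝓣B 𝓑' (26 / 5) (1 / 100) (1 / 8) (1 / 25) (constTol (1 / 25)) τ₁' T₁')
    (hEncB : SlavingEnclosureG 𝓣B 𝓑' (26 / 5) (1 / 100) (1 / 8) τ₁' T₁' κ' σ' H' F' X')
    (hPB₁ : PairKernelCert (famAnd 𝓣B 𝓡') 𝓑' τ₁' T₁' κ' σ' H' F' X' (1 / 25) (constTol (1 / 25)) B₁)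
    (hPB₂ : PairKernelCert (famAnd (famAndNot 𝓣B 𝓡') 𝓟') 𝓑' τ₁' T₁' κ' σ' H' F' X' (1 / 25) (constTol (1 / 25)) B₂)
    (hPB₃ : PairKernelCert (famAndNot (famAndNot 𝓣B 𝓡') 𝓟') 𝓑' τ₁' T₁' κ' σ' H' F' X' (1 / 25) (constTol (1 / 25)) B₃)
    (hNBhi : RefineGB (famAndNot (famAndNot (famAnd 𝓘₀ (Dense dA)) 𝓡) (Dense dB)) 𝓗 (26 / 5) (1 / 100) (1 / 8) (1 / 25) (constTol (1 / 25)) (1 / 25)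
      (constTol (1 / 25)) (stepPair 𝓡' B₁ (stepPair 𝓟' B₂ B₃)))
    (h𝓗 : FamilyLE (famAndNot 𝓘₀ (Dense dA)) 𝓗) (hcap : PairLE (stepPair 𝓡' B₁ (stepPair 𝓟' B₂ B₃)) (pairSum (constTol (1 / 25))))
    (h𝓘 : FamilyLE 𝓗 𝓘)
    (hF : AnnularPhaseFloor (63 / 10) (24 / 5) (63 / 10) (1 / 1000)) (hP : PolyTextureFloor (63 / 10) (24 / 5) (1 / 1000))
    (hA : AnnularDefectFloor (24 / 5) (63 / 10)) (hD : DefectiveCollarFloor (24 / 5))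
    (h2 : CrowdedCoreMotifPricingCapK (1 / 1000) (9 / 5) (133 / 10) (3 / 2) (effPot w₄₅ ω₄ (3 / 400)) (-(7175 / 10000) + 3 / 400)
      (Collar (9 / 2) fun N y j => (∃ s : ℝ, 0 ≤ s ∧ s ≤ 3 / 2 ∧ NonEquilibriumCore (-(7175 / 10000)) 0 7 s (1 / 10000) N y j) ∨
        GoodAtScale (1 / 20) (3 / 2) y j))
    (h3 : DiluteDefectMotifPricingCapK (1 / 1000) (9 / 5) (133 / 10) (3 / 2) (effPot w₄₅ ω₄ (3 / 400)) (-(7175 / 10000) + 3 / 400)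
      (Collar (9 / 2) fun N y j => (∃ s : ℝ, 0 ≤ s ∧ s ≤ 3 / 2 ∧ NonEquilibriumCore (-(7175 / 10000)) 0 7 s (1 / 10000) N y j) ∨
        GoodAtScale (1 / 20) (3 / 2) y j)) :
    Summit.AtomisticToContinuum.Crystallization.Theses.FrustratedLawDichotomy.AperiodicFrustratedLawGap :=
  aperiodicFrustratedLawGap_of_homFloor_fourSector_split_A35000_T26_record hε0 hε1 hDX hE
    (homFloor_of_semOKF_semOKHQ level_ok_fallback_A35000_T26 hFcc hHcp) hT hR hED hEBlo hEBhi hEA hK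
    (refineGB_stepPair3_of_kernelCut_glued h𝓣D hRD hEncD hPD₁ hPD₂ hPD₃) (refineGB_stepPair3_of_kernelCut_glued h𝓣B hRB hEncB hPB₁ hPB₂ hPB₃)
    hNBhi h𝓗 hcap h𝓘 hF hP hA hD h2 h3

end Consumers

end Summit.AtomisticToContinuum.Crystallization.Theorems.FrustratedLawDichotomyAperiodicGapRecordJunctionHysteresis

end
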